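import Literature.Geometry.Riemannian.CyclicCoverProper
import Literature.Geometry.Riemannian.AlmostNonnegRicciFibrationProofs
import HarnessLib

/-!
# The deck group of the cyclic cover is generated by short translations
(Huang–Huang–Wang–Zhu 2026, §4: "`Hᵢ` is generated by `Hᵢ(3)`")

H. Huang, X.-T. Huang, J. Wang, X. Zhu, arXiv:2605.24380 (2026), §4, p. 13: "Since
`diam(Mᵢ) ≤ 1`, by a standard argument, `Hᵢ` is generated by `Hᵢ(3)`", where for a group `H` of
isometries of the cover `M̂` and the base point `p̂`, `H(r) = {h ∈ H | d(h p̂, p̂) < r}` (§2.1,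
p. 6). The standard argument (Gromov's short generators) is the tree's abstract theorem
`subgroupClosure_setOf_dist_smul_lt_eq_top` (`AlmostNonnegRicciFibrationProofs.lean`, §2: a group
acting isometrically on a preconnected pseudometric space with a `D`-dense orbit of `p` is
generated by `{g | dist (g • p) p < 2D + ε}`). Here it is applied to the actual covers of the
`b = 1` case: the connected infinite cyclic cover `X̂ = CircleMaps.CyclicCover f` of a Riemannian
manifold `(X, g)` with all distances `< D`, its lifted metric `ĝ = proj^* g` and Riemannian
distance `d̂` (`CyclicCoverMetric.lean`, `CyclicCoverDistance.lean`: `ℤ` acts by `d̂`-isometries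
with `D`-dense orbits; `CyclicCoverProper.lean`):

* `addSubgroupClosure_setOf_edist_vadd_lt_eq_top` — **`ℤ` is generated by
  `ℤ(2D + ε) = {k | d̂(k +ᵥ p̂, p̂) < 2D + ε}`** for every `ε > 0` and every `p̂`
  (with `D = 1`, `ε = 1`: `Hᵢ = ⟨Hᵢ(3)⟩`).

The proof equips `X̂` with the (pseudo)metric space structure of `d̂` (Mathlib's
`PseudoEMetricSpace.ofRiemannianMetric`, distances being finite on the connected cover) and the
isometric action of `Multiplicative ℤ`, and transports the conclusion back to the additive group.
Everything is proved; no definitions, no named facts.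

## References

* H. Huang, X.-T. Huang, J. Wang, X. Zhu, arXiv:2605.24380 (2026), §2.1 (p. 6), §4 (p. 13).
  [HuangHuangWangZhu2026]
* P. Petersen, *Riemannian Geometry*, 2nd ed., GTM 171 (2006), Ch. 9 (Ricci curvature
  comparison: fundamental groups), Gromov's lemma on generators of length `≤ 2 diam M`.
  [Petersen2006]
-/

noncomputable section

open Bundle Set Filter Function
open scoped Manifold ContDiff Topology ENNReal NNReal

namespace Literature.Geometry.Riemannian

open Literature.Geometry.Lorentzian Literature.Geometry.Lorentzian.PseudoRiemannianMetric
  Literature.Geometry.Manifold Literature.Topology.FourManifolds.CircleMaps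
  Literature.Topology.FourManifolds.CircleMaps.CyclicCover

variable {E : Type*} [NormedAddCommGroup E] [NormedSpace ℝ E]
  {H : Type*} [TopologicalSpace H] {I : ModelWithCorners ℝ E H}
  {X : Type*} [TopologicalSpace X] [ChartedSpace H X] [IsManifold I ∞ X]
  [FiniteDimensional ℝ E] [T2Space X]
  (f : C(X, Circle)) (g : PseudoRiemannianMetric I ∞ E (TangentSpace I : X → Type _))

/-- **The deck group of the connected cyclic cover of a manifold of diameter `< D` is generated
by its `(2D + ε)`-short elements** (Huang–Huang–Wang–Zhu 2026, §4, p. 13: "`Hᵢ` is generated by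
`Hᵢ(3)`"; Gromov's short generators, the tree's `subgroupClosure_setOf_dist_smul_lt_eq_top`): if
all Riemannian distances in `X` are `< D` and the infinite cyclic cover `X̂` of `X` along `f` is
connected, then for every `ε > 0` and `p̂ ∈ X̂` the additive group `ℤ` is generated by
`{k | d̂(k +ᵥ p̂, p̂) < 2D + ε}`, `d̂` the Riemannian distance of the lifted metric.
[cite: HuangHuangWangZhu2026, §4 p. 13 and §2.1 p. 6] -/
theorem addSubgroupClosure_setOf_edist_vadd_lt_eq_top [ConnectedSpace (CyclicCover f)]
    (hg : g.IsRiemannian) {D : ℝ≥0} (hD : ∀ x y : X, g.edist hg x y < D) {ε : ℝ} (hε : 0 < ε)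
    (p : CyclicCover f) :
    AddSubgroup.closure {k : ℤ | (liftMetric f g).edist (isRiemannian_liftMetric f g hg)
      (k +ᵥ p) p < ENNReal.ofReal (2 * D + ε)} = ⊤ := by
  have hĝ : (liftMetric f g).IsRiemannian := isRiemannian_liftMetric f g hg
  haveI : LocallyCompactSpace (CyclicCover f) := Manifold.locallyCompact_of_finiteDimensional I
  haveI : RegularSpace (CyclicCover f) := inferInstance
  -- the (pseudo)metric space structure of `d̂`
  letI := (liftMetric f g).riemannianBundle hĝ
  haveI := (liftMetric f g).isContinuousRiemannianBundle hĝ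
  letI iE : PseudoEMetricSpace (CyclicCover f) := .ofRiemannianMetric I (CyclicCover f)
  have hed : ∀ x y : CyclicCover f, edist x y = (liftMetric f g).edist hĝ x y := fun _ _ ↦ rfl
  have hfin : ∀ x y : CyclicCover f, edist x y ≠ ⊤ := fun x y ↦ by
    rw [hed]
    exact PseudoRiemannianMetric.edist_ne_top hĝ x y
  letI iM : PseudoMetricSpace (CyclicCover f) := PseudoEMetricSpace.toPseudoMetricSpace hfin
  have hdist : ∀ x y : CyclicCover f, dist x y = ((liftMetric f g).edist hĝ x y).toReal :=
    fun _ _ ↦ rfl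
  -- the deck group acts by isometries of `d̂`
  haveI : IsIsometricVAdd ℤ (CyclicCover f) := ⟨fun k x y ↦ by
    show (liftMetric f g).edist hĝ (k +ᵥ x) (k +ᵥ y) = (liftMetric f g).edist hĝ x y
    exact edist_liftMetric_vadd f g hg k x y⟩
  -- the orbit of `p` is `D`-dense
  have hdense : ∀ x : CyclicCover f, ∃ k : Multiplicative ℤ, dist (k • p) x ≤ (D : ℝ) := fun x ↦ by
    obtain ⟨k, hk⟩ := exists_edist_vadd_lt f hg (hD (proj x) (proj p))
    refine ⟨Multiplicative.ofAdd k, ?_⟩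
    show dist (k +ᵥ p) x ≤ D
    rw [dist_comm, hdist]
    have h := ENNReal.toReal_mono ENNReal.coe_ne_top hk.le
    rwa [ENNReal.coe_toReal] at h
  -- Gromov's short generators, for the isometric action of `Multiplicative ℤ`
  have key := subgroupClosure_setOf_dist_smul_lt_eq_top (G := Multiplicative ℤ) p hε hdense
  -- back to the additive group
  apply AddSubgroup.toSubgroup.injective
  rw [AddSubgroup.toSubgroup_closure, OrderIso.map_top]
  convert key using 2
  ext k
  simp only [mem_preimage, mem_setOf_eq]
  show (liftMetric f g).edist hĝ (Multiplicative.toAdd k +ᵥ p) p < ENNReal.ofReal (2 * D + ε) ↔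
    ((liftMetric f g).edist hĝ (Multiplicative.toAdd k +ᵥ p) p).toReal < 2 * D + ε
  exact ENNReal.lt_ofReal_iff_toReal_lt (PseudoRiemannianMetric.edist_ne_top hĝ _ _)

/-- **`Hᵢ = ⟨Hᵢ(3)⟩`** (Huang–Huang–Wang–Zhu 2026, §4, p. 13, verbatim normalisation): if all
distances in `X` are `< 1` — e.g. `diam X ≤ 1` up to the harmless strict inequality, take
`D = 1`, `ε = 1` — the deck group of the connected cyclic cover is generated by the translations
moving `p̂` by less than `3`. [cite: HuangHuangWangZhu2026, §4 p. 13] -/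
theorem addSubgroupClosure_setOf_edist_vadd_lt_three_eq_top [ConnectedSpace (CyclicCover f)]
    (hg : g.IsRiemannian) (hD : ∀ x y : X, g.edist hg x y < 1) (p : CyclicCover f) :
    AddSubgroup.closure {k : ℤ | (liftMetric f g).edist (isRiemannian_liftMetric f g hg)
      (k +ᵥ p) p < 3} = ⊤ := by
  have h := addSubgroupClosure_setOf_edist_vadd_lt_eq_top f g hg (D := 1)
    (by simpa using hD) one_pos p
  have h3 : ENNReal.ofReal (2 * ((1 : ℝ≥0) : ℝ) + 1) = 3 := by
    rw [NNReal.coe_one]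
    norm_num
  rwa [h3] at h

end Literature.Geometry.Riemannian
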